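import Summits.ResolutionOfSingularities.ResolutionOfSingularities.Theorems.EquisingularLiftEquisingularLiftNatTowerBTriplePrimePointStepsFE
import Summits.ResolutionOfSingularities.ResolutionOfSingularities.Theorems.EquisingularLiftEquisingularLiftNatTowerBFourRoundOfFact
import Summits.ResolutionOfSingularities.ResolutionOfSingularities.Theorems.EquisingularLiftEquisingularLiftNatTowerNestDefs
import HarnessLib

/-!
# [OURS · L1 W4.5(b) · EL♮(3) · T23-A⁵ «NEST»] THE NEST STEP PRESERVES THE A⁗ ENGINE INVARIANT

WIDTH TABLE D3 «NEST» (desk RULING R39), toward brick D3-3 (res-L1-w45b-stub-4 g11, A-engine owner): the fifth generating step `TowerNestB₅` (D3-1,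
`…NatTowerNestDefs`) preserves the A⁗ tower motive `INV₁‴` at `FE` — by COMPOSITION of two landed closures: the in-carrier point step with the running surface
:= the fresh plane (`Tower.towerPtRegB₄_invB₁_FE`, ✓ p627628, first `E'`-menu option) and res-type-027's embedded round at a curve inside the running surface
(`Tower.invB₄_embRound_of_fact_anyPrime`, ✓ `…NatTowerBFourRoundOfFact`, host `H = E'`, shadow `KH = K'`, the (T-k) instance `EmbeddedCurveLift` inside).
No new upstairs mathematics (crit-2 PRE-CLEAR l.82490, crit-3 l.82475).  `--supports stmt-ResolutionOfSingularities-20148`, no claim, counted 0.  AI-produced;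
NOT a statement of [Hironaka2017]; EL♮(3) is NOT proved here.
-/

set_option linter.dupNamespace false
set_option linter.overlappingInstances false

noncomputable section

open CategoryTheory CategoryTheory.Limits AlgebraicGeometry TopologicalSpace Topology IsLocalRing
open Literature.AlgebraicGeometry.Resolution
open AlgebraicGeometry.Scheme.IdealSheafData
open Summit.ResolutionOfSingularities.ResolutionOfSingularities.Theses.EquisingularLift.Split
open Summit.ResolutionOfSingularities.ResolutionOfSingularities.Cruxes.EquisingularLift.StrataSplit

namespace Summit.ResolutionOfSingularities.ResolutionOfSingularities.Cruxes.EquisingularLiftNat.Sections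


variable (O : Type) [CommRing O] [IsDomain O] [IsDiscreteValuationRing O] [IsAdicComplete (IsLocalRing.maximalIdeal O) O]
    [IsAlgClosed (IsLocalRing.ResidueField O)] (k : Type) [Field k]
    (θ : O →+* k) (hθ : Function.Surjective θ)
    (P : Scheme.{0}) [IsIntegral P] (q : P ⟶ Spec (.of O)) [IsProper q] [SmoothOfRelativeDimension 3 q] (Y : Set P)
    (hYsp : Y ⊆ q ⁻¹' {IsLocalRing.closedPoint O}) (hYirr : IsIrreducible Y) (hYcl : IsClosed Y)
    (hPnoeth : IsLocallyNoetherian P) (hPreg : Scheme.IsRegular P)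
    (Ch : ∀ X' : Scheme.{0}, (X' ⟶ P) → Set X' → Prop)
    (hChStep : ∀ (X' X'' : Scheme.{0}) (σ' : X' ⟶ P) (S' : Set X') (C : X'.IdealSheafData) (τ : X'' ⟶ X'),
      Ch X' σ' S' → IsBlowup τ C → Scheme.IsRegular C.subscheme → Flat (C.subschemeι ≫ σ' ≫ q) →
      σ' '' (C.support : Set X') ⊆ {y | ¬ IsGenericPoint y Y} → (C.support : Set X') ∩ (σ' ≫ q) ⁻¹' {IsLocalRing.closedPoint O} ⊆ S' →
      Ch X'' (τ ≫ σ') (closure (τ ⁻¹' (S' \ (C.support : Set X')))))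
    (hChSplit : ∀ (X' : Scheme.{0}) (σ' : X' ⟶ P) (S' : Set X'), Ch X' σ' S' → Chain P Y X' σ' S')

include hθ hYsp hYirr hYcl hPnoeth hPreg hChStep hChSplit

/-- **`(nest)⁵` on the engine invariant `INV₁‴` at `FE`**: the in-carrier point step with the fresh plane as running surface
(`Tower.towerPtRegB₄_invB₁_FE`, p627628) followed by res-type-027's embedded round at a curve inside the running surface
(`Tower.invB₄_embRound_of_fact_anyPrime`, host `= E'`, shadow `= K'`). [OURS · L1 W4.5b · T23-A⁵ engine] -/
theorem Tower.towerNestB₅_invB₁_FE (hFact : EmbeddedCurveLift O k θ P q) :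
    ∀ (F₉ : Scheme.{0}) (Z₉ : Set F₉) (hZ₉ : IsClosed Z₉) (F₁₀ : Scheme.{0}) (υ' : F₁₀ ⟶ F₉),
      TowerNestB₅ F₁₀ (fun G γ T E Es Ns K =>
        (Tower.InvB₄ O k θ P q Y Ch (fun _ _ _ _ _ _ _ _ _ σ _ 𝓔 => Flat (𝓔.subschemeι ≫ σ ≫ q)) F₉ Z₉ hZ₉ F₁₀ υ' G γ T E Es Ns K ∧
          IsClosed K ∧ K ⊆ closure (K \ E) ∧ K ≠ Set.univ) ∧
        (∀ z : ↥(redSub F₉ Z₉ hZ₉), IsClosed ({z} : Set ↥(redSub F₉ Z₉ hZ₉)) →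
          ringKrullDim ((redSub F₉ Z₉ hZ₉).presheaf.stalk z) = ((1 : ℕ) : WithBot ℕ∞)) ∧ IsLocallyNoetherian F₉) := by
  intro F₉ Z₉ hZ₉ F₁₀ υ' G G' G'' γ T E Es Ns K y υ₂ hy K' E' hE' Es' Ns' Z hZ υ₃ K'' E'' Es'' Ns'' hI hyT hyreg hbl hK' hE'eq hEs' hNs'
    hZsub hZne _hZirr hZreg hEZreg hunobs hZdim hυ₃ hK'' hE'' hEs'' hNs''
  -- (1) the point step, running surface := the fresh plane
  obtain ⟨hI', hcar, hnoeth⟩ := Tower.towerPtRegB₄_invB₁_FE O k θ hθ P q Y hYsp hYirr hYcl hPnoeth hPreg Ch hChStep hChSplit F₉ Z₉ hZ₉ F₁₀ υ'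
    G G' γ T E Es Ns K y υ₂ hy K' E' Es' Ns' hI hyT hyreg hbl hK' (Or.inl hE'eq) hEs' hNs'
  -- (2) the embedded round at `Z ⊆ E'` (host = the running surface, shadow = `K'`)
  refine ⟨?_, hcar, hnoeth⟩
  haveI := hnoeth
  exact Tower.invB₄_embRound_of_fact_anyPrime O k θ hθ P q Y hYsp hYirr hYcl hPnoeth hPreg Ch hChStep hChSplit hFact Z₉ hZ₉ υ' G' G'' (υ₂ ≫ γ)
    (closure (υ₂ ⁻¹' (T \ {curvePt G T y}))) E' Es' Ns' K' E' K' hE' Z hZ υ₃ K'' E'' Es'' Ns'' hI' (Or.inl ⟨rfl, rfl⟩) hZsub hZne hZreg hEZreg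
    hunobs hZdim hυ₃ hK'' hE'' hEs'' hNs''

end Summit.ResolutionOfSingularities.ResolutionOfSingularities.Cruxes.EquisingularLiftNat.Sections

end
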